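import Mathlib
import Summits.KontsevichZagierPeriods.Zeta5Search.CollinearityCriterionProof
import Summits.KontsevichZagierPeriods.Zeta5Search.CellKitLevel
import Summits.KontsevichZagierPeriods.Zeta5Search.RecordCellDClassDataProof
import Summits.KontsevichZagierPeriods.Zeta5Search.LemmaDBonus
import HarnessLib

/-!
# ζ(5) search — exponent vectors, type data and tame classes (tools for gen-2 g8's `LemmaDBonus` = THEOREM LB♯♯, part 1 of 2)

Cell `pub-zeta5` (HONEST FRAMING: systematic search; no irrationality claim unless certified), typer seat generation 10.
The hypotheses of `LemmaDBonus` (`Zeta5Search/LemmaDBonus.lean`) speak of the EXPONENT VECTOR `expVector b p x` (a `List ℤ`) through the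
Boolean tests `droppedPair` / `sameType`.  This file turns them into the level-class language of P1 g6 (`LevelClassDigits`, `CellKitLevel`):

* §1 `expVector_level`: for a level class `x < p`, `x + Lp ≤ b₀ < x + (L+1)p`, the exponent vector is the list `[netExp(x + kp)]_{k ≤ L}`;
  the conjugate class carries the reversed list (`expVector_conj_level`, `map_range_reverse`); equal (resp. reversed) exponent vectors of two
  level classes mean equal `L` and equal (resp. reflected) exponent functions (`levelData_of_map_eq`).
* §2 type data of a centre-free level class: `ĉ_x` (`cHat_level`, the analogue of P1's `vHat_level`; the pole count is P1's
  `CellD.classPoleCount_level`); hence two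
  centre-free level classes with the same exponent function have the same `ĉ`, `v̂`, pole count, class exponent and `σ_K` (`typeData_eq`).
* §3 the orbit vectors read in `ZMod p` (`cast_orbitK`, `cast_orbitV`), `ḡ_x ≠ 0` (`cast_gHat_ne_zero`), and the TAME-CLASS LEMMA
  `cast_vHat_eq_zero_of_classNu_nonneg`: a selected class with `ν_x ≥ 0` has `v̄_x = 0` (its `V_x` is `p`-integral while U-V pins the digit).

Nothing here bears on irrationality.
-/

noncomputable section

open Finset

namespace Summit.KontsevichZagierPeriods.Zeta5Search.ClusterValuation

open Summit.KontsevichZagierPeriods.Zeta5Search.DualSeries (InBox)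
open Summit.KontsevichZagierPeriods.Zeta5Search.WedgeDictionary (coeffV dOf)
open Summit.KontsevichZagierPeriods.Zeta5Search.CasoratianValuation (InPolytope shift)
open Summit.KontsevichZagierPeriods.Zeta5Search.PadicSeries
open Summit.KontsevichZagierPeriods.Zeta5Search.LevelClass (typeRho typeV typeExp classSet_level level_injective classPoles_level
  classRho_level classExp_level vHat_level padicNorm_vHat_le_one)
open Summit.KontsevichZagierPeriods.Zeta5Search.CellKit (conj_level netExp_conj_level)

variable {p : ℕ} [hp : Fact p.Prime]

/-! ## §1  The exponent vector of a level class -/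

omit hp in
/-- Reversing a list indexed by `0..L`. -/
theorem map_range_reverse {β : Type*} (f : ℕ → β) (L : ℕ) :
    ((List.range (L + 1)).map f).reverse = (List.range (L + 1)).map (fun k => f (L - k)) := by
  have h1 : (List.range (L + 1)).reverse = (List.range (L + 1)).map (fun k => L - k) := by
    conv_lhs => rw [List.range_eq_range', List.reverse_range']
    exact List.map_congr_left fun k _ => (by omega : 0 + (L + 1) - 1 - k = L - k)
  rw [← List.map_reverse, h1, List.map_map]
  rfl

omit hp in
/-- Two lists indexed by `0..L`, `0..L'` agree iff `L = L'` and the entries agree. -/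
theorem levelData_of_map_eq {β : Type*} {f g : ℕ → β} {L L' : ℕ}
    (h : (List.range (L + 1)).map f = (List.range (L' + 1)).map g) : L = L' ∧ ∀ k ≤ L, f k = g k := by
  have hlen := congrArg List.length h
  simp only [List.length_map, List.length_range] at hlen
  have hLL : L' = L := by omega
  subst hLL
  exact ⟨rfl, fun k hk => List.map_inj_left.1 h k (List.mem_range.2 (by omega))⟩

section ExpVector

variable (b : ℕ → ℤ) {x L : ℕ} (hx : x < p) (hL : x + L * p ≤ (b 0).toNat) (hL' : (b 0).toNat < x + L * p + p)
include hx hL hL'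

/-- The class of a level class, as the INCREASING LIST `[x, x+p, …, x+Lp]`. -/
theorem classList_level :
    ((List.range ((b 0).toNat + 1)).filter fun s => s % p = x % p) = (List.range (L + 1)).map (fun k => x + k * p) := by
  have hp0 : 0 < p := hp.out.pos
  have hcl := classSet_level b hx hL hL'
  refine (List.pairwise_lt_range.filter _).sortedLT.eq_of_mem_iff
    ((List.pairwise_lt_range.map (fun k => x + k * p)
      (fun a c h => Nat.add_lt_add_left (Nat.mul_lt_mul_of_pos_right h hp0) x)).sortedLT) ?_
  intro s
  rw [List.mem_filter, List.mem_range, List.mem_map, decide_eq_true_iff]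
  constructor
  · rintro ⟨hs, hres⟩
    have hmem : s ∈ classSet b p x := Finset.mem_filter.2 ⟨Finset.mem_range.2 hs, hres⟩
    rw [hcl, Finset.mem_image] at hmem
    obtain ⟨k, hk, hks⟩ := hmem
    exact ⟨k, List.mem_range.2 (Finset.mem_range.1 hk), hks⟩
  · rintro ⟨k, hk, rfl⟩
    have hmem : x + k * p ∈ classSet b p x := by
      rw [hcl]; exact Finset.mem_image.2 ⟨k, Finset.mem_range.2 (List.mem_range.1 hk), rfl⟩
    obtain ⟨hr, hres⟩ := Finset.mem_filter.1 hmem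
    exact ⟨Finset.mem_range.1 hr, hres⟩

/-- **The exponent vector of a level class is `[netExp(x + kp)]_{k ≤ L}`.** -/
theorem expVector_level : expVector b p x = (List.range (L + 1)).map (fun k => netExp b (x + k * p)) := by
  unfold expVector
  rw [classList_level b hx hL hL', List.map_map]
  rfl

/-- **The conjugate class carries the reversed exponent vector.** -/
theorem expVector_conj_level (h0 : 0 ≤ b 0) :
    expVector b p (conjClass b p x) = (List.range (L + 1)).map (fun k => netExp b (x + (L - k) * p)) := by
  obtain ⟨hx', hM, hM'⟩ := conj_level b hx hL hL'
  rw [expVector_level b hx' hM hM']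
  exact List.map_congr_left fun k hk => netExp_conj_level b hL hL' h0 (by have := List.mem_range.1 hk; omega)

end ExpVector

omit hp in
/-- The level count of a residue `x < p ≤ b₀`: `L = ⌊(b₀ − x)/p⌋`. -/
theorem level_bounds (b : ℕ → ℤ) {x : ℕ} (hp0 : 0 < p) (hxn : x ≤ (b 0).toNat) :
    x + ((b 0).toNat - x) / p * p ≤ (b 0).toNat ∧ (b 0).toNat < x + ((b 0).toNat - x) / p * p + p := by
  have h1 := Nat.div_add_mod ((b 0).toNat - x) p
  have h2 := Nat.mod_lt ((b 0).toNat - x) hp0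
  constructor
  · have : ((b 0).toNat - x) / p * p ≤ (b 0).toNat - x := Nat.div_mul_le_self _ _
    omega
  · have : p * (((b 0).toNat - x) / p) = ((b 0).toNat - x) / p * p := mul_comm _ _
    omega

/-! ## §2  Type data of a centre-free level class -/

section TypeData

variable (b : ℕ → ℤ) {x L : ℕ} (hx : x < p) (hL : x + L * p ≤ (b 0).toNat) (hL' : (b 0).toNat < x + L * p + p)
include hx hL hL'

/-- **`ĉ_x` of a centre-free level class in terms of the type** (the level of `x + kp` is `k`). -/
theorem cHat_level (e : ℕ → ℤ) (he : ∀ k ≤ L, netExp b (x + k * p) = e k) (hc : ¬ CentreIn b p x) :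
    cHat b p x = ∑ i ∈ (range (L + 1)).filter (fun i => e i < 0),
      ((((i : ℕ) : ℚ)) ^ 2 * typeRho L e i 1 + if e i ≤ -2 then 2 * ((i : ℕ) : ℚ) * typeRho L e i 2 else 0) := by
  have hP : classPoles b p x = ((range (L + 1)).filter fun k => e k < 0).image fun k => x + k * p :=
    classPoles_level b hx hL hL' e he
  unfold cHat
  rw [hP, sum_image (fun a _ c _ h => level_injective hp.out.pos x h)]
  refine sum_congr rfl fun k hk => ?_
  have hkL : k ≤ L := by have := mem_range.1 (mem_filter.1 hk).1; omega
  have hlev : (x + k * p) / p = k := by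
    rw [Nat.add_mul_div_right _ _ hp.out.pos, Nat.div_eq_of_lt hx, zero_add]
  rw [he k hkL, hlev, classRho_level b hx hL hL' e he hc hkL 1, classRho_level b hx hL hL' e he hc hkL 2]

end TypeData

/-- **Equal types give equal data.**  Two centre-free level classes with the same `L` and the same exponent function have the same
`ĉ`, `v̂`, pole count and class exponent. -/
theorem typeData_eq (b : ℕ → ℤ) {x y L : ℕ} (hx : x < p) (hL : x + L * p ≤ (b 0).toNat) (hL' : (b 0).toNat < x + L * p + p)
    (hy : y < p) (hM : y + L * p ≤ (b 0).toNat) (hM' : (b 0).toNat < y + L * p + p)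
    (hcx : ¬ CentreIn b p x) (hcy : ¬ CentreIn b p y) (he : ∀ k ≤ L, netExp b (x + k * p) = netExp b (y + k * p)) :
    cHat b p x = cHat b p y ∧ vHat b p x = vHat b p y ∧ classPoleCount b p x = classPoleCount b p y ∧
      classExp b p x = classExp b p y := by
  set e : ℕ → ℤ := fun k => netExp b (y + k * p) with hedef
  have hey : ∀ k ≤ L, netExp b (y + k * p) = e k := fun k _ => rfl
  refine ⟨?_, ?_, ?_, ?_⟩
  · rw [cHat_level b hx hL hL' e he hcx, cHat_level b hy hM hM' e hey hcy]
  · have h1 : vHat b p x = typeV L e := vHat_level b hx hL hL' e he hcx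
    have h2 : vHat b p y = typeV L e := vHat_level b hy hM hM' e hey hcy
    rw [h1, h2]
  · rw [CellD.classPoleCount_level b hx hL hL' e he, CellD.classPoleCount_level b hy hM hM' e hey]
  · rw [classExp_level b hx hL hL' e he hcx, classExp_level b hy hM hM' e hey hcy]

omit hp in
/-- … and hence the same `σ_K`. -/
theorem sigmaK_eq_of_typeData {b : ℕ → ℤ} {x y : ℕ} (hc : cHat b p x = cHat b p y)
    (hn : classPoleCount b p x = classPoleCount b p y) : sigmaK b p x = sigmaK b p y := by
  unfold sigmaK; rw [hc, hn]

/-! ## §3  Orbit vectors in `ZMod p`, and tame classes -/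

/-- `ḡ_x ≠ 0`: the unit `ĝ_x` does not vanish in `ZMod p`. -/
theorem cast_gHat_ne_zero (b : ℕ → ℤ) (hp5 : 5 ≤ p) (x : ℕ) : ((gHat b p x : ℚ) : ZMod p) ≠ 0 := by
  classical
  rw [(cast_gHat b hp5 x).2]
  refine mul_ne_zero ?_ (prod_ne_zero_iff.2 fun w hw => zpow_ne_zero _ (sub_ne_zero.2 (ne_of_mem_erase hw)))
  intro h
  have h' : ((2 : ℕ) : ZMod p) = 0 := by exact_mod_cast h
  rw [ZMod.natCast_eq_zero_iff] at h'
  have := Nat.le_of_dvd two_pos h'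
  omega

section Orbit

variable (b : ℕ → ℤ) (h0 : 0 ≤ b 0) (hn : (b 0).toNat < p ^ 2) (hp2 : p ≠ 2) (N x : ℕ)
include h0 hn hp2

/-- `σ_K(x)` is `p`-integral. -/
theorem den_sigmaK : ¬ p ∣ (sigmaK b p x).den := PInt.of_padicNorm_le_one (padicNorm_sigmaK_le_one b h0 hn hp2 x)

/-- `v̂_x` is `p`-integral. -/
theorem den_vHat : ¬ p ∣ (vHat b p x).den := PInt.of_padicNorm_le_one (padicNorm_vHat_le_one b h0 hn hp2)

/-- The orbit vector `P_K(x)` is `p`-integral … -/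
theorem den_orbitK : ¬ p ∣ (orbitK b p N x).den := by
  have hs : ¬ p ∣ ((-1 : ℚ) ^ (N + 1)).den := PInt.pow (PInt.neg PInt.one) _
  have h2 : ¬ p ∣ (2 : ℚ).den := by simpa using PInt.intCast (p := p) 2
  unfold orbitK
  split_ifs
  · exact PInt.mul h2 (den_sigmaK b h0 hn hp2 x)
  · exact PInt.add (den_sigmaK b h0 hn hp2 x) (PInt.mul hs (den_sigmaK b h0 hn hp2 _))

/-- … and so is `P_V(x)`. -/
theorem den_orbitV : ¬ p ∣ (orbitV b p N x).den := by
  have hs : ¬ p ∣ ((-1 : ℚ) ^ (N + 1)).den := PInt.pow (PInt.neg PInt.one) _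
  have h2 : ¬ p ∣ (2 : ℚ).den := by simpa using PInt.intCast (p := p) 2
  unfold orbitV
  split_ifs
  · exact PInt.mul h2 (den_vHat b h0 hn hp2 x)
  · exact PInt.add (den_vHat b h0 hn hp2 x) (PInt.mul hs (den_vHat b h0 hn hp2 _))

/-- **`P_K(x)` in `ZMod p`.** -/
theorem cast_orbitK : ((orbitK b p N x : ℚ) : ZMod p) =
    if CentreIn b p x then 2 * ((sigmaK b p x : ℚ) : ZMod p)
    else ((sigmaK b p x : ℚ) : ZMod p) + (-1 : ZMod p) ^ (N + 1) * ((sigmaK b p (conjClass b p x) : ℚ) : ZMod p) := by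
  have hs : ¬ p ∣ ((-1 : ℚ) ^ (N + 1)).den := PInt.pow (PInt.neg PInt.one) _
  have h2 : ¬ p ∣ (2 : ℚ).den := by simpa using PInt.intCast (p := p) 2
  unfold orbitK
  split_ifs
  · rw [PInt.cast_mul h2 (den_sigmaK b h0 hn hp2 x)]; push_cast; rfl
  · rw [PInt.cast_add (den_sigmaK b h0 hn hp2 x) (PInt.mul hs (den_sigmaK b h0 hn hp2 _)),
      PInt.cast_mul hs (den_sigmaK b h0 hn hp2 _)]
    push_cast; rfl

/-- **`P_V(x)` in `ZMod p`.** -/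
theorem cast_orbitV : ((orbitV b p N x : ℚ) : ZMod p) =
    if CentreIn b p x then 2 * ((vHat b p x : ℚ) : ZMod p)
    else ((vHat b p x : ℚ) : ZMod p) + (-1 : ZMod p) ^ (N + 1) * ((vHat b p (conjClass b p x) : ℚ) : ZMod p) := by
  have hs : ¬ p ∣ ((-1 : ℚ) ^ (N + 1)).den := PInt.pow (PInt.neg PInt.one) _
  have h2 : ¬ p ∣ (2 : ℚ).den := by simpa using PInt.intCast (p := p) 2
  unfold orbitV
  split_ifs
  · rw [PInt.cast_mul h2 (den_vHat b h0 hn hp2 x)]; push_cast; rfl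
  · rw [PInt.cast_add (den_vHat b h0 hn hp2 x) (PInt.mul hs (den_vHat b h0 hn hp2 _)),
      PInt.cast_mul hs (den_vHat b h0 hn hp2 _)]
    push_cast; rfl

end Orbit

section Tame

variable (b : ℕ → ℤ) (hb : InPolytope b) (hp5 : 5 ≤ p) (hwin : (b 0 + 2 : ℤ) < (p : ℤ) ^ 2)
  {N : ℕ} (hN : 3 ≤ N)
  (hT : ∀ x, x < p → 1 ≤ classPoleCount b p x → classExp b p x < -(N : ℤ) →
    classPoleCount b p x = 1 ∧ 0 ≤ classNu b p x)
  (S : Finset ℕ) (hsel : ∀ x ∈ S, classExp b p x = -(N : ℤ))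
  (hnsel : ∀ x, x < p → x ∉ S → classExp b p x = -(N : ℤ) → 1 ≤ classPoleCount b p x →
    classPoleCount b p x = 1 ∧ 0 ≤ classNu b p x)
include hb hp5 hwin hN hT hsel hnsel

/-- **The tame-class lemma**: a selected pole class with `ν_x ≥ 0` has `v̄_x = 0` in `ZMod p` (`V_x` is then `p`-integral, so its normalised
digit `ḡ_x v̄_x`, pinned by U-V, vanishes; and `ḡ_x ≠ 0`). -/
theorem cast_vHat_eq_zero_of_classNu_nonneg {x : ℕ} (hx : x < p) (hxS : x ∈ S) (hpos : 1 ≤ classPoleCount b p x)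
    (hnu : 0 ≤ classNu b p x) : ((vHat b p x : ℚ) : ZMod p) = 0 := by
  obtain ⟨hbox, -, -, hn⟩ := thmA_data b hb hwin
  have h0 : 0 ≤ b 0 := hbox.1
  have hp2 : p ≠ 2 := by omega
  have hp1 : (1 : ℚ) ≤ p := one_le_p
  have hd := norm_vTilde_sub_le b hb hp5 hwin hN hT S hsel hnsel hx
  rw [if_pos hxS] at hd
  -- `‖(−p)^N V_x‖ ≤ p^{−N} ≤ p⁻¹`
  have hT0 : padicNorm p ((-(p : ℚ)) ^ (N : ℤ) * classV b p x) ≤ (p : ℚ) ^ (-(1 : ℤ)) := by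
    rw [padicNorm.mul, LevelClass.padicNorm_neg_p_zpow]
    have hV := padicNorm_classV_le b hb hp5 hwin hx hpos
    calc (p : ℚ) ^ (-(N : ℤ)) * padicNorm p (classV b p x)
        ≤ (p : ℚ) ^ (-(N : ℤ)) * (p : ℚ) ^ (-classNu b p x) := mul_le_mul_of_nonneg_left hV (zpow_p_nonneg _)
      _ ≤ (p : ℚ) ^ (-(1 : ℤ)) * 1 :=
        mul_le_mul (zpow_le_zpow_right₀ hp1 (by omega)) (zpow_le_one_of_nonpos₀ hp1 (by omega))
          (zpow_p_nonneg _) (zpow_p_nonneg _)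
      _ = _ := mul_one _
  have hgv : padicNorm p (gHat b p x * vHat b p x) ≤ (p : ℚ) ^ (-(1 : ℤ)) := by
    have e : gHat b p x * vHat b p x = (-(p : ℚ)) ^ (N : ℤ) * classV b p x -
        ((-(p : ℚ)) ^ (N : ℤ) * classV b p x - gHat b p x * vHat b p x) := by ring
    rw [e]
    exact (padicNorm.sub (p := p)).trans (max_le hT0 hd)
  have hden_g := (cast_gHat b hp5 x).1
  have hden_v := den_vHat b h0 hn hp2 x
  have hcast : ((gHat b p x * vHat b p x : ℚ) : ZMod p) = 0 :=
    (PInt.cast_eq_zero_iff_norm (PInt.mul hden_g hden_v)).2 hgv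
  rw [PInt.cast_mul hden_g hden_v] at hcast
  exact (mul_eq_zero.1 hcast).resolve_left (cast_gHat_ne_zero b hp5 x)

end Tame

end Summit.KontsevichZagierPeriods.Zeta5Search.ClusterValuation

end
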